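import Literature.RingTheory.Flat.IsomorphismModuloNilpotent
import Literature.RingTheory.AdicTopology.FreeOfProjectiveTruncations
import Mathlib.LinearAlgebra.Basis.Basic
import HarnessLib

/-!
# [Schlessinger1968, Lemma 3.4, proof]: lifting a basis along a square-zero/nilpotent extension into a flat module

Family `hodge` (computation cell `pub-hsemireg`, LIT-W seat «Pridham / derived deformation theory as printed»), layer
`Literature/RingTheory/Flat`. The constructive step of the printed proof of [Schlessinger1968, Lemma 3.4, p. 217]
(flatness of `N = M' ×_M M''` over `B = A' ×_A A''`, free case): with `A''/J ≅ A`, `J` nilpotent, `M''` flat over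
`A''` and `u'' : M'' → M` inducing `M'' ⊗_{A''} A ≅ M`,

«Choose a basis `(x'_i)_{i ∈ I}` for `M'`. Then by (ii) we find that `M` is the free module on generators `u'(x'_i)`.
Choosing `x''_i ∈ M''` such that `u''(x''_i) = u'(x'_i)`, we get a map `Σ_I A'' x''_i → M''` of `A''` modules, whose
reduction modulo the ideal `J` is an isomorphism. Therefore `M''` is free on generators `x''_i` (Lemma 3.3)».

Typed here for a ring map `q : R₂ → R₀`, SURJECTIVE with NILPOTENT kernel `J`, a FLAT `R₂`-module `M₂`, a
`q`-semilinear `u : M₂ → M₀` with `ker u = J · M₂` (= «`u''` induces `M'' ⊗_{A''} A ≅ M`», the surjectivity half of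
which is not needed), a basis `b₀` of `M₀` over `R₀` and lifts `x i ∈ M₂`, `u (x i) = b₀ i`:
* `linearCombination_bijective_of_lift_basis` — `Σ_I R₂ x_i → M₂` is bijective («whose reduction modulo the ideal `J`
  is an isomorphism. Therefore …», by `bijective_of_bijective_mapQ_of_isNilpotent` = Lemma 3.3);
* `exists_basis_of_lift_basis` — «`M''` is free on generators `x''_i`»: there is a basis `b₂` of `M₂` with
  `b₂ i = x i`.
THEOREMS only; no definition, no named fact, no `sorry` (the tree's
`Literature.RingTheory.AdicTopology.finsupp_mem_smul_top_of_forall_mem` is reused). Not here: the fibre-product module `N = M' ×_M M''` over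
`B = A' ×_A A''` and the rest of Lemma 3.4 / Corollary 3.6.

## References
* [Schlessinger1968] M. Schlessinger, Functors of Artin rings, Trans. AMS 130 (1968): Lemma 3.4 and its proof,
  pp. 216–217 (held text `paper:doi-10-1090-s0002-9947-1968-0217093-3`, p0009–p0010).
-/

universe u u' v w z

namespace Literature.RingTheory.Flat

open Literature.RingTheory.AdicTopology (smul_top_le_comap_smul_top finsupp_mem_smul_top_of_forall_mem)

variable {R₂ : Type u} {R₀ : Type u'} [CommRing R₂] [CommRing R₀]
  {M₂ : Type v} {M₀ : Type w} [AddCommGroup M₂] [Module R₂ M₂] [AddCommGroup M₀] [Module R₀ M₀]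
  {ι : Type z}

/-- `u (Σ f_i x_i) = Σ q(f_i) b₀_i` for a `q`-semilinear `u` with `u (x i) = b₀ i`.
[cite: Schlessinger1968, Lemma 3.4 (proof), p. 217] -/
theorem apply_linearCombination_eq_of_lift {q : R₂ →+* R₀} (u : M₂ →ₛₗ[q] M₀) (b₀ : ι → M₀) (x : ι → M₂)
    (hx : ∀ i, u (x i) = b₀ i) (f : ι →₀ R₂) :
    u (Finsupp.linearCombination R₂ x f) =
      Finsupp.linearCombination R₀ b₀ (Finsupp.mapRange q (map_zero q) f) := by
  rw [Finsupp.linearCombination_apply, Finsupp.linearCombination_apply, map_finsuppSum,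
    Finsupp.sum_mapRange_index (fun i => zero_smul R₀ (b₀ i))]
  exact Finset.sum_congr rfl fun i _ => by simp only [map_smulₛₗ, hx]

/-- **[Schlessinger1968, Lemma 3.4, proof]: «we get a map `Σ_I A'' x''_i → M''` of `A''` modules, whose reduction
modulo the ideal `J` is an isomorphism. Therefore …» (Lemma 3.3).** For `q : R₂ → R₀` surjective with nilpotent kernel
`J`, `M₂` flat, `u : M₂ → M₀` `q`-semilinear with `ker u = J · M₂`, `b₀` a basis of `M₀` and lifts `u (x i) = b₀ i`,
the map `Σ_I R₂ x_i → M₂` is BIJECTIVE. [cite: Schlessinger1968, Lemma 3.4 (proof), p. 217, with Lemma 3.3 p. 216] -/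
theorem linearCombination_bijective_of_lift_basis [Module.Flat R₂ M₂] {q : R₂ →+* R₀} (hq : Function.Surjective q)
    (hJ : IsNilpotent (RingHom.ker q)) (u : M₂ →ₛₗ[q] M₀) (hu : LinearMap.ker u = RingHom.ker q • ⊤)
    (b₀ : Module.Basis ι R₀ M₀) (x : ι → M₂) (hx : ∀ i, u (x i) = b₀ i) :
    Function.Bijective (Finsupp.linearCombination R₂ x) := by
  set J := RingHom.ker q with hJdef
  set v := Finsupp.linearCombination R₂ x with hv
  refine bijective_of_bijective_mapQ_of_isNilpotent hJ v ⟨fun a b hab => ?_, fun m => ?_⟩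
  · -- injectivity of `v̄`: `v f ∈ J M₂ = ker u` forces `q (f i) = 0` for all `i`
    obtain ⟨f, rfl⟩ := Submodule.Quotient.mk_surjective _ a
    obtain ⟨g, rfl⟩ := Submodule.Quotient.mk_surjective _ b
    rw [Submodule.mapQ_apply, Submodule.mapQ_apply, Submodule.Quotient.eq] at hab
    rw [Submodule.Quotient.eq]
    rw [← map_sub, ← hu, LinearMap.mem_ker, hv, apply_linearCombination_eq_of_lift u b₀ x hx] at hab
    have h0 : Finsupp.mapRange q (map_zero q) (f - g) = 0 :=
      b₀.linearIndependent.finsuppLinearCombination_injective (by rw [hab, map_zero])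
    refine finsupp_mem_smul_top_of_forall_mem J (f - g) fun i => ?_
    rw [hJdef, RingHom.mem_ker]
    have := DFunLike.congr_fun h0 i
    rwa [Finsupp.mapRange_apply, Finsupp.zero_apply] at this
  · -- surjectivity of `v̄`: lift the coordinates of `u m` in the basis `b₀` along `q`
    obtain ⟨m, rfl⟩ := Submodule.Quotient.mk_surjective _ m
    obtain ⟨a, ha⟩ := Finsupp.mapRange_surjective q (map_zero q) hq (b₀.repr (u m))
    refine ⟨Submodule.Quotient.mk a, ?_⟩
    rw [Submodule.mapQ_apply, Submodule.Quotient.eq, ← hu, LinearMap.mem_ker, map_sub, hv,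
      apply_linearCombination_eq_of_lift u b₀ x hx, ha, b₀.linearCombination_repr, sub_self]

/-- **[Schlessinger1968, Lemma 3.4, proof]: «Therefore `M''` is free on generators `x''_i` (Lemma 3.3)».** Under the
hypotheses of `linearCombination_bijective_of_lift_basis` the lifts `x i` form a basis of `M₂`.
[cite: Schlessinger1968, Lemma 3.4 (proof), p. 217, with Lemma 3.3 p. 216] -/
theorem exists_basis_of_lift_basis [Module.Flat R₂ M₂] {q : R₂ →+* R₀} (hq : Function.Surjective q)
    (hJ : IsNilpotent (RingHom.ker q)) (u : M₂ →ₛₗ[q] M₀) (hu : LinearMap.ker u = RingHom.ker q • ⊤)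
    (b₀ : Module.Basis ι R₀ M₀) (x : ι → M₂) (hx : ∀ i, u (x i) = b₀ i) :
    ∃ b₂ : Module.Basis ι R₂ M₂, ∀ i, b₂ i = x i := by
  have hbij := linearCombination_bijective_of_lift_basis hq hJ u hu b₀ x hx
  have hli : LinearIndependent R₂ x := linearIndependent_iff_injective_finsuppLinearCombination.2 hbij.1
  have hsp : ⊤ ≤ Submodule.span R₂ (Set.range x) := by
    rw [← Finsupp.range_linearCombination, LinearMap.range_eq_top.2 hbij.2]
  exact ⟨Module.Basis.mk hli hsp, fun i => Module.Basis.mk_apply hli hsp i⟩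

/-- In particular `M₂` is free («`M''` is free»). [cite: Schlessinger1968, Lemma 3.4 (proof), p. 217] -/
theorem free_of_lift_basis [Module.Flat R₂ M₂] {q : R₂ →+* R₀} (hq : Function.Surjective q)
    (hJ : IsNilpotent (RingHom.ker q)) (u : M₂ →ₛₗ[q] M₀) (hu : LinearMap.ker u = RingHom.ker q • ⊤)
    (b₀ : Module.Basis ι R₀ M₀) (x : ι → M₂) (hx : ∀ i, u (x i) = b₀ i) : Module.Free R₂ M₂ := by
  obtain ⟨b₂, -⟩ := exists_basis_of_lift_basis hq hJ u hu b₀ x hx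
  exact Module.Free.of_basis b₂

end Literature.RingTheory.Flat
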